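import Summits.QuantumFields.YangMills.Theorems.SwapVirialDeficitBlowUpPeriodicTwoScaleFamily
import Summits.QuantumFields.YangMills.Theorems.SwapVirialDeficitBlowUpPeriodicBox
import Summits.QuantumFields.YangMills.Theorems.SwapVirialDeficitTwoScaleCalculusMin
import HarnessLib

/-!
# The PERIODIC massive-mode rung, brick PM-IIb: THE STRUCTURE THEOREM `G(u, s; ξ) = u⁴·s²·Φ(u, s; ξ)` for the two-scale deficit, with `Φ` continuous —
# the JOINT two-scale limit of the periodic fibre condition
# (free-hands support of ⟨stmt-QuantumFields-24196⟩ `SwapVirialDeficit.ToronSoftnessSharp`; LEAD memo `sfw-p2-g96-memo-24196-PM-design.md` §1; consumes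
# ✓PM-I½ `twoScaleDeficit`/`contDiff_twoScaleDeficit_pair`, ✓PM-IIa/IIa′ `TwoScaleCalculus.*`, ✓`PeriodicRingFloor.ringDeficit_le_of_commBox`)

The one analytic input PM of ✓`periodicPrincipalLogLimit_of_twoScale` needs the fibre condition `G(u, s; ξ) ≤ (u²s)²` of ✓`twoScaleFibre` to have a limit as
BOTH chart parameters `(u, s) = (ρ, t/ρ²)` go to zero.  This file proves it from three facts only — (S) joint smoothness (✓PM-I½), (T) toron flatness, (N)
non-negativity — via the generic calculus ✓`TwoScaleCalculus.eq_pow_four_mul_sq_of_slices`: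
* §A ★★ `periodicChartDeficit_eq_zero_of_comm` — (T) IN THE CHART: pairwise commuting leaders and trivial followers have zero periodic deficit
  (✓`ringDeficit_le_of_commBox` at `t₂ = s = 0`); `quatToSU2_comm`, ✓`ZeroModeSigma.axial_comm` + `quat_comm_of_imI_im{K,J}_eq_zero`, `quatToSU2_dilateIm_zero_of_pos`;
* §B `imQ`, `RawSpace L = (Fin 4 → ℍ) × (Fol L → ℍ)`, `baseLead`, ★ `hatA` = the deficit with FIXED real parts `Q(x₀ᵏ + Im v_k)`, `Q(y₀ᶠ + Im v_f)` — `C^∞` on the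
  WHOLE raw space at a non-degenerate point (`contDiff_hatA`), `≥ 0`, and zero at commuting perturbations with trivial followers (`hatA_eq_zero_of_comm`);
* §C the parabola: `dirOne s w' = c₁(s)` (leader velocity, = `abelDir compI i + abelDir (compJ s) j + abelDir (compK s) k`), `dirTwo s y = c₂(s)` (follower
  acceleration), ★★ `twoScaleDeficit_eq_hatA : G(u, s; ξ) = Â(u·c₁(s) + u²·c₂(s))`, `hatA_abelDir_eq_zero` (each abelian piece is a toron line: `Â ≡ 0`);
* §D ★★ `hess_hatA_dirOne_eq_zero` — LEMMA H: `c₁(s)` is a null direction of the Hessian of `Â` at `0` (PSD + abelian lines + Cauchy–Schwarz,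
  ✓`hess_apply_eq_zero_of_line_const`), ★★ `iteratedDeriv_twoScaleDeficit_eq_zero` (slices have vanishing jets of order `< 4`, ✓`iteratedDeriv_parabola_eq_zero`),
  `twoScaleDeficit_zero_right/left`, and ★★★ `twoScaleDeficit_eq_pow_four_mul_sq`:
  `twoScaleDeficit L u s a₀ w' y = u⁴ · s² · twoScaleRemainder (fun q => twoScaleDeficit L q.1 q.2 a₀ w' y) u s` for ALL `(u, s)` at every point with
  `x₀ᵏ ≠ 0`, `a₀ ≠ 0`, `0 < y₀ᶠ`; ★★ `tendsto_twoScaleDeficit_div` (the JOINT limit `G/(u⁴s²) → Φ(0,0;ξ)`), ★ `twoScaleDeficit_le_iff` (`G ≤ (u²s)² ⟺ Φ ≤ 1` off the axes).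
What remains for PM: the non-degeneracy of `Φ(0,0;·)` (null level `{Φ = 1}`), the `(u, s)`-free dominator, the DCT for `twoScaleVolume` (PM-IIc/d), and w3 g64's
extraction PM-III — see the LEAD memo §2–§3.
HONEST LABEL: finite-dimensional calculus on the blow-up chart (plan-level fixed-`L` rung of a DRAFT line); PM, ⟨24196⟩, ⟨24194⟩, ⟨24197⟩, ⟨24497⟩ NOT proved;
own crux ⟨22884⟩ OPEN (blocked-on ⟨19935⟩); the Yang–Mills mass gap is NOT proved; no summit is proved by a line.
LEAD seat ym-line-sfw-p2 g96 (cell ym-idea-1, free hands), `--supports stmt-QuantumFields-24196`.  Defs `imQ`, `baseLead`, `hatA`, `qI/qJ/qK`, `compI/J/K`, `abelDir`,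
`dirOne`, `dirTwo` + abbrev `RawSpace`; standard axioms, 0 `sorry`.
References: [cite: Luscher1983, §2]; [cite: GonzalezarroyoAltes1988]; [folklore].
-/

set_option autoImplicit false

noncomputable section

open Quaternion Set Filter Topology
open scoped Quaternion BigOperators ContDiff
open Literature.MathematicalPhysics.QuantumLattice
open Literature.MathematicalPhysics.QuantumFieldTheory hiding SU2
open Summit.QuantumFields.YangMills.Theorems.SwapTwistDeficit.ToronLog

namespace Summit.QuantumFields.YangMills.Theorems.SwapVirialDeficit.BlowUpRing

open Summit.QuantumFields.YangMills.Theorems.FemtoTransferGap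
open Summit.QuantumFields.YangMills.Theorems.FemtoTransferGap.TT
open Summit.QuantumFields.YangMills.Theorems.VirialFluxGap.RingDeficit
open Summit.QuantumFields.YangMills.Theorems.SwapTwistDeficit.PeriodicRingFloor (ringDeficit_le_of_commBox leader_not_treeEdge)
open Literature.Analysis.Calculus (radialUnit radialUnit_def)
open Summit.QuantumFields.YangMills.Theorems.SwapVirialDeficit.ZeroModeSigma (dilateIm dilateIm_apply su2Quat_quatToSU2_eq_radialUnit axial_comm)
open Summit.QuantumFields.YangMills.Theorems.SwapVirialDeficit.BlowUp (su2_comm_of_su2Quat_comm su2_eq_of_su2Quat_eq quatToSU2_follower_zero_of_pos)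

variable {L : ℕ} [NeZero L]

/-! ## §A Toron flatness in the chart (input (T) of the structure theorem) -/

/-- `‖1 − 1‖_F ≤ 0` in `SU(2)`. [folklore] -/
theorem frobNorm_coe_one_sub_one_le : frobNorm ((((1 : SU2)) : Matrix (Fin 2) (Fin 2) ℂ) - 1) ≤ 0 := by
  rw [show (((1 : SU2)) : Matrix (Fin 2) (Fin 2) ℂ) = 1 from rfl, sub_self, frobNorm_zero]

/-- ★★ **TORON FLATNESS IN THE CHART**: if the four leaders commute pairwise and every follower is `1`, the periodic chart deficit vanishes
(✓`PeriodicRingFloor.ringDeficit_le_of_commBox` at `t₂ = s = 0`: every tree-gauge variable sits AT its letter). [cite: Luscher1983, §2] -/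
theorem periodicChartDeficit_eq_zero_of_comm (C : Fin 4 → SU2) (hC : ∀ μ ν : Fin 4, C μ * C ν = C ν * C μ) :
    periodicChartDeficit L (fun _ => false) (fun _ => 1) (C, fun _ => 1) = 0 := by
  set q : (Fin 4 → SU2) × (Fol L → SU2) := (C, fun _ => 1) with hq
  have hF : ringDeficit L (fun _ => false) ((Fin.cons (glue (ringConfig (fun _ => 1) q).1) (ringConfig (fun _ => 1) q).2.1 :
      Fin (2 * L - 1 + 1) → GaugeConfig 3 L SU2), (ringConfig (fun _ => 1) q).2.2) = periodicChartDeficit L (fun _ => false) (fun _ => 1) q := rfl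
  have hle := ringDeficit_le_of_commBox (L := L) (t₂ := 0) (s := 0) le_rfl le_rfl (ringConfig (fun _ => 1) q).1 (ringConfig (fun _ => 1) q).2.1
    (ringConfig (fun _ => 1) q).2.2 ?_ ?_ ?_ ?_ ?_
  · rw [hF] at hle
    have h0 : (0 : ℝ) + 0 = 0 := add_zero 0
    rw [h0] at hle
    simp only [ne_eq, OfNat.ofNat_ne_zero, not_false_eq_true, zero_pow, mul_zero] at hle
    exact le_antisymm hle (periodicChartDeficit_nonneg _ _ _)
  · intro μ ν
    simp only [ringConfig_fst_lead, hq]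
    rw [hC (Fin.castSucc μ) (Fin.castSucc ν), sub_self, frobNorm_zero]
  · intro μ
    simp only [ringConfig_fst_lead, ringConfig_snd_snd_zero, hq]
    rw [hC (Fin.last 3) (Fin.castSucc μ), sub_self, frobNorm_zero]
  · intro i
    by_cases h : isLead i = true
    · -- the leader link itself: `i = (−ê_μ, μ)`
      have hi1 : i.1.1 = Pi.single i.1.2 (-1 : ZMod L) := by simpa [isLead] using h
      have hcond : i.1.1 i.1.2 = -1 := by rw [hi1]; simp
      rw [if_pos hcond]
      have hidx : (⟨(Pi.single i.1.2 (-1 : ZMod L), i.1.2), leader_not_treeEdge i.1.2⟩ : OffIdx L) = i := by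
        apply Subtype.ext
        exact Prod.ext hi1.symm rfl
      rw [hidx, inv_mul_cancel]
      exact frobNorm_coe_one_sub_one_le
    · have hw := ringConfig_fst_of_not_isLead (fun _ => (1 : SU2)) q ⟨i, h⟩
      simp only at hw
      rw [hw]
      have hl : (if i.1.1 i.1.2 = -1 then (ringConfig (fun _ => (1 : SU2)) q).1 ⟨(Pi.single i.1.2 (-1 : ZMod L), i.1.2), leader_not_treeEdge i.1.2⟩
          else 1) = letter (fun μ => q.1 (Fin.castSucc μ)) i := by
        simp only [ringConfig_fst_lead]; rfl
      rw [hl, hq]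
      simp only [mul_one, inv_mul_cancel]
      exact frobNorm_coe_one_sub_one_le
  · intro j e
    rw [ringConfig_snd_fst, hq]
    simp only [mul_one, inv_mul_cancel]
    exact frobNorm_coe_one_sub_one_le
  · intro x
    by_cases hx : x = 0
    · subst hx
      rw [inv_mul_cancel]
      exact frobNorm_coe_one_sub_one_le
    · have h := ringConfig_snd_snd_of_ne (fun _ => (1 : SU2)) q ⟨x, hx⟩
      simp only at h
      rw [h, ringConfig_snd_snd_zero, hq]
      simp only [one_mul, mul_one, inv_mul_cancel]
      exact frobNorm_coe_one_sub_one_le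

/-! ## Commuting quaternion letters -/

/-- Two quaternions in the `(1, j)`-plane commute. [folklore] -/
theorem quat_comm_of_imI_imK_eq_zero {p q : ℍ} (hpI : p.imI = 0) (hpK : p.imK = 0) (hqI : q.imI = 0) (hqK : q.imK = 0) : p * q = q * p := by
  ext <;> simp [hpI, hpK, hqI, hqK] <;> ring

/-- Two quaternions in the `(1, k)`-plane commute. [folklore] -/
theorem quat_comm_of_imI_imJ_eq_zero {p q : ℍ} (hpI : p.imI = 0) (hpJ : p.imJ = 0) (hqI : q.imI = 0) (hqJ : q.imJ = 0) : p * q = q * p := by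
  ext <;> simp [hpI, hpJ, hqI, hqJ] <;> ring

/-- ★ Normalisations of commuting non-zero quaternions commute in `SU(2)`. [folklore] -/
theorem quatToSU2_comm {p q : ℍ} (hp : p ≠ 0) (hq : q ≠ 0) (h : p * q = q * p) : quatToSU2 p * quatToSU2 q = quatToSU2 q * quatToSU2 p := by
  apply su2_comm_of_su2Quat_comm
  rw [su2Quat_quatToSU2_eq_radialUnit hp, su2Quat_quatToSU2_eq_radialUnit hq, radialUnit_def, radialUnit_def,
    smul_mul_smul_comm, smul_mul_smul_comm ‖q‖⁻¹, h, mul_comm ‖q‖⁻¹]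

/-- A follower at scale `0` with positive real part is the identity: `Q(dilateIm 0 y) = 1`. [folklore] -/
theorem quatToSU2_dilateIm_zero_of_pos {y : ℍ} (hy : 0 < y.re) : quatToSU2 (dilateIm 0 y) = 1 := by
  have h := quatToSU2_follower_zero_of_pos (1 : ℍ) hy
  rw [one_mul] at h
  rw [h]
  exact Summit.QuantumFields.YangMills.Theorems.WeakCouplingRates.quatToSU2_one


/-! ## §B The raw perturbation space with FIXED real parts; the deficit `hatA` is globally smooth there -/

/-- The imaginary part of a quaternion, as a quaternion: `imQ q = (0, q_I, q_J, q_K)`. [folklore] -/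
def imQ (q : ℍ) : ℍ := ⟨0, q.imI, q.imJ, q.imK⟩

/-- `re (imQ q) = 0`. [folklore] -/
@[simp] theorem imQ_re (q : ℍ) : (imQ q).re = 0 := rfl
/-- `imI (imQ q) = imI q`. [folklore] -/
@[simp] theorem imQ_imI (q : ℍ) : (imQ q).imI = q.imI := rfl
/-- `imJ (imQ q) = imJ q`. [folklore] -/
@[simp] theorem imQ_imJ (q : ℍ) : (imQ q).imJ = q.imJ := rfl
/-- `imK (imQ q) = imK q`. [folklore] -/
@[simp] theorem imQ_imK (q : ℍ) : (imQ q).imK = q.imK := rfl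

section ImQ
variable {E : Type*} [NormedAddCommGroup E] [NormedSpace ℝ E] {n : ℕ∞}

/-- `imQ` is `C^n` along `C^n` data. [folklore] -/
theorem contDiff_imQ {q : E → ℍ} (hq : ContDiff ℝ n q) : ContDiff ℝ n fun p => imQ (q p) := by
  unfold imQ
  exact contDiff_quat_mk contDiff_const (Literature.Analysis.FluidPDE.Tao2016.contDiff_quat_imI.comp hq)
    (Literature.Analysis.FluidPDE.Tao2016.contDiff_quat_imJ.comp hq) (Literature.Analysis.FluidPDE.Tao2016.contDiff_quat_imK.comp hq)

end ImQ

/-- A real letter plus an imaginary perturbation keeps its real part, hence never vanishes if the real part is non-zero. [folklore] -/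
theorem coe_add_imQ_ne_zero {c : ℝ} (hc : c ≠ 0) (q : ℍ) : (c : ℍ) + imQ q ≠ 0 := by
  intro h
  have := congrArg (fun z : ℍ => z.re) h
  simp at this
  exact hc this

variable (L) in
/-- **The raw perturbation space** of the two-scale family: four leader quaternions and `Fol L` follower quaternions. [folklore] -/
abbrev RawSpace : Type := (Fin 4 → ℍ) × (Fol L → ℍ)

/-- The real parts of the four leaders in ✓`axialLetters` order `(x, z, y, hub)`. [folklore] -/
def baseLead (a₀ : ℝ) (w' : (ℍ × ℍ) × ℍ) : Fin 4 → ℝ := ![w'.1.1.re, w'.2.re, w'.1.2.re, a₀]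

variable (L) in
/-- ★ **The deficit with FIXED real parts** `Â(v)`: leaders `Q(x₀ᵏ + Im v_k)`, followers `Q(y₀ᶠ + Im v_f)` — smooth on ALL of the raw space when the
real parts are non-zero; the two-scale family is `Â` along the parabola `u ↦ u·c₁ + u²·c₂`. [cite: Luscher1983, §2] -/
def hatA (a₀ : ℝ) (w' : (ℍ × ℍ) × ℍ) (y : Fol L → ℍ) (v : RawSpace L) : ℝ :=
  periodicChartDeficit L (fun _ => false) (fun _ => 1)
    (fun μ => quatToSU2 (((baseLead a₀ w' μ : ℝ) : ℍ) + imQ (v.1 μ)), fun i => quatToSU2 ((((y i).re : ℝ) : ℍ) + imQ (v.2 i)))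

/-- `0 ≤ Â`. [cite: Luscher1983, §2] -/
theorem hatA_nonneg (a₀ : ℝ) (w' : (ℍ × ℍ) × ℍ) (y : Fol L → ℍ) (v : RawSpace L) : 0 ≤ hatA L a₀ w' y v :=
  periodicChartDeficit_nonneg _ _ _

/-- The real parts are non-zero at a non-degenerate point. [folklore] -/
theorem baseLead_ne_zero {a₀ : ℝ} {w' : (ℍ × ℍ) × ℍ} (hx : w'.1.1.re ≠ 0) (hy' : w'.1.2.re ≠ 0) (hz : w'.2.re ≠ 0) (ha : a₀ ≠ 0) (μ : Fin 4) :
    baseLead a₀ w' μ ≠ 0 := by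
  fin_cases μ <;> simpa [baseLead]

/-- ★★ **`Â` is `C^∞` on the whole raw space** at a non-degenerate point (✓PM-0a `contDiff_periodicChartDeficit_param`). [folklore] -/
theorem contDiff_hatA {a₀ : ℝ} {w' : (ℍ × ℍ) × ℍ} {y : Fol L → ℍ} (hx : w'.1.1.re ≠ 0) (hy' : w'.1.2.re ≠ 0) (hz : w'.2.re ≠ 0) (ha : a₀ ≠ 0)
    (hf : ∀ i, (y i).re ≠ 0) : ContDiff ℝ ∞ (hatA L a₀ w' y) := by
  unfold hatA
  refine contDiff_periodicChartDeficit_param (L := L) (fun _ => false) (fun _ => 1) (fun μ => ?_) (fun i => ?_)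
  · refine contDiff_su2Quat_quatToSU2_comp (contDiff_const.add (contDiff_imQ ((contDiff_apply ℝ ℍ μ).comp contDiff_fst)))
      fun v => coe_add_imQ_ne_zero (baseLead_ne_zero hx hy' hz ha μ) _
  · refine contDiff_su2Quat_quatToSU2_comp (contDiff_const.add (contDiff_imQ ((contDiff_apply ℝ ℍ i).comp contDiff_snd)))
      fun v => coe_add_imQ_ne_zero (hf i) _

/-- ★ **`Â` vanishes at perturbations with trivial followers and pairwise commuting leader letters** (toron flatness ✓`periodicChartDeficit_eq_zero_of_comm`). [cite: Luscher1983, §2] -/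
theorem hatA_eq_zero_of_comm {a₀ : ℝ} {w' : (ℍ × ℍ) × ℍ} {y : Fol L → ℍ} (hf : ∀ i, 0 < (y i).re) (hbase : ∀ μ, baseLead a₀ w' μ ≠ 0)
    {v : RawSpace L} (hv : v.2 = 0)
    (hcomm : ∀ μ ν, (((baseLead a₀ w' μ : ℝ) : ℍ) + imQ (v.1 μ)) * (((baseLead a₀ w' ν : ℝ) : ℍ) + imQ (v.1 ν)) =
      (((baseLead a₀ w' ν : ℝ) : ℍ) + imQ (v.1 ν)) * (((baseLead a₀ w' μ : ℝ) : ℍ) + imQ (v.1 μ))) :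
    hatA L a₀ w' y v = 0 := by
  unfold hatA
  have hfol : (fun i => quatToSU2 ((((y i).re : ℝ) : ℍ) + imQ (v.2 i))) = fun _ => (1 : SU2) := by
    funext i
    rw [hv]
    simp only [Pi.zero_apply]
    have him : imQ (0 : ℍ) = 0 := by ext <;> simp [imQ]
    rw [him, add_zero]
    have h1 : (((y i).re : ℝ) : ℍ) = (y i).re • (1 : ℍ) := by rw [Algebra.smul_def, mul_one]; rfl
    rw [h1, quatToSU2_smul (hf i)]
    exact Summit.QuantumFields.YangMills.Theorems.WeakCouplingRates.quatToSU2_one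
  rw [hfol]
  exact periodicChartDeficit_eq_zero_of_comm _ fun μ ν =>
    quatToSU2_comm (coe_add_imQ_ne_zero (hbase μ) _) (coe_add_imQ_ne_zero (hbase ν) _) (hcomm μ ν)

/-! ## §C The directions of the two-scale parabola and their abelian pieces -/

/-- The unit imaginary quaternions `i, j, k`. [folklore] -/
def qI : ℍ := ⟨0, 1, 0, 0⟩
/-- The unit imaginary quaternion `j`. [folklore] -/
def qJ : ℍ := ⟨0, 0, 1, 0⟩
/-- The unit imaginary quaternion `k`. [folklore] -/
def qK : ℍ := ⟨0, 0, 0, 1⟩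

/-- The `i`-components of the leader velocity: `(x_I, z_I, y_I, 1)` (the hub letter `a₀ + u·i` moves along `i` with unit speed). [folklore] -/
def compI (w' : (ℍ × ℍ) × ℍ) : Fin 4 → ℝ := ![w'.1.1.imI, w'.2.imI, w'.1.2.imI, 1]
/-- The `j`-components of the leader velocity at transverse ratio `s`: `s·(x_J, z_J, y_J, 0)`. [folklore] -/
def compJ (s : ℝ) (w' : (ℍ × ℍ) × ℍ) : Fin 4 → ℝ := ![s * w'.1.1.imJ, s * w'.2.imJ, s * w'.1.2.imJ, 0]
/-- The `k`-components of the leader velocity at transverse ratio `s`: `s·(x_K, z_K, y_K, 0)`. [folklore] -/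
def compK (s : ℝ) (w' : (ℍ × ℍ) × ℍ) : Fin 4 → ℝ := ![s * w'.1.1.imK, s * w'.2.imK, s * w'.1.2.imK, 0]

variable (L) in
/-- The abelian leader direction with components `c` along the imaginary unit `e` (followers fixed). [folklore] -/
def abelDir (c : Fin 4 → ℝ) (e : ℍ) : RawSpace L := (fun μ => c μ • e, 0)

variable (L) in
/-- ★ **The leader velocity** `c₁(s) = Σ_{n ∈ {i,j,k}}` abelian pieces: leaders move as `u·(x_I i + s·x_⊥)`, hub as `u·i`, followers do not move at first order. [folklore] -/
def dirOne (s : ℝ) (w' : (ℍ × ℍ) × ℍ) : RawSpace L := abelDir L (compI w') qI + abelDir L (compJ s w') qJ + abelDir L (compK s w') qK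

variable (L) in
/-- ★ **The follower acceleration** `c₂(s) = (0; s·Im y)`: followers move as `u²s·Im y`. [folklore] -/
def dirTwo (s : ℝ) (y : Fol L → ℍ) : RawSpace L := (0, fun i => s • imQ (y i))

/-- ★★ **THE TWO-SCALE FAMILY IS `Â` ALONG THE PARABOLA**: `G(u, s; a₀, w', y) = Â(u·c₁(s) + u²·c₂(s))`. [folklore] -/
theorem twoScaleDeficit_eq_hatA (u s a₀ : ℝ) (w' : (ℍ × ℍ) × ℍ) (y : Fol L → ℍ) :
    twoScaleDeficit L u s a₀ w' y = hatA L a₀ w' y (u • dirOne L s w' + u ^ 2 • dirTwo L s y) := by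
  unfold twoScaleDeficit hatA
  congr 1
  refine Prod.ext ?_ ?_
  · funext μ
    show twoScaleLeaders u s a₀ w' μ = _
    fin_cases μ <;>
      simp only [twoScaleLeaders, Matrix.cons_val_zero, Matrix.cons_val_one, Matrix.cons_val, Fin.zero_eta, Fin.mk_one, Fin.reduceFinMk,
        dirOne, dirTwo, abelDir, baseLead, compI, compJ, compK, Prod.fst_add, Prod.smul_fst, Pi.add_apply, Pi.smul_apply,
        Pi.zero_apply, smul_zero, add_zero] <;>
      (congr 1; ext <;> simp [twoScaleRaw, hubRaw, imQ, qI, qJ, qK] <;> ring)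
  · funext i
    show twoScaleFollowers L (u ^ 2 * s) y i = _
    simp only [twoScaleFollowers, dirOne, dirTwo, abelDir, Prod.snd_add, Prod.smul_snd, Pi.add_apply, Pi.smul_apply,
      Pi.zero_apply, add_zero, smul_zero, zero_add]
    congr 1
    rw [dilateIm_apply]
    ext <;> simp [imQ] <;> ring

/-- Along an abelian direction `t ↦ t·abelDir c e` with `e ∈ {i, j, k}`, all leader letters lie in the plane `span(1, e)` and commute; so `Â` vanishes there. [folklore] -/
theorem hatA_abelDir_eq_zero {a₀ : ℝ} {w' : (ℍ × ℍ) × ℍ} {y : Fol L → ℍ} (hf : ∀ i, 0 < (y i).re) (hbase : ∀ μ, baseLead a₀ w' μ ≠ 0)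
    (c : Fin 4 → ℝ) {e : ℍ} (he : e = qI ∨ e = qJ ∨ e = qK) (t : ℝ) : hatA L a₀ w' y (t • abelDir L c e) = 0 := by
  refine hatA_eq_zero_of_comm hf hbase (by simp [abelDir]) fun μ ν => ?_
  simp only [abelDir, Prod.smul_fst, Pi.smul_apply, smul_smul]
  rcases he with rfl | rfl | rfl
  · exact axial_comm (by simp [imQ, qI]) (by simp [imQ, qI]) (by simp [imQ, qI]) (by simp [imQ, qI])
  · exact quat_comm_of_imI_imK_eq_zero (by simp [imQ, qJ]) (by simp [imQ, qJ]) (by simp [imQ, qJ]) (by simp [imQ, qJ])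
  · exact quat_comm_of_imI_imJ_eq_zero (by simp [imQ, qK]) (by simp [imQ, qK]) (by simp [imQ, qK]) (by simp [imQ, qK])

omit [NeZero L] in
/-- At `s = 0` the leader velocity is purely along `i`: `c₁(0) = abelDir (compI w') i` (and `c₂(0) = 0`). [folklore] -/
theorem dirOne_zero (w' : (ℍ × ℍ) × ℍ) : dirOne L 0 w' = abelDir L (compI w') qI := by
  unfold dirOne abelDir compJ compK
  refine Prod.ext ?_ (by simp)
  funext μ
  fin_cases μ <;> simp

omit [NeZero L] in
/-- At `s = 0` the follower acceleration vanishes. [folklore] -/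
theorem dirTwo_zero (y : Fol L → ℍ) : dirTwo L 0 y = 0 := by
  unfold dirTwo; ext i <;> simp


/-! ## §D The structure theorem for the periodic two-scale deficit -/

open Summit.QuantumFields.YangMills.Theorems.SwapVirialDeficit.TwoScaleCalculus

section Structure

variable {a₀ : ℝ} {w' : (ℍ × ℍ) × ℍ} {y : Fol L → ℍ}

/-- ★★ **LEMMA H FOR THE TWO-SCALE FAMILY**: at a non-degenerate point with positive follower real parts, the leader velocity `c₁(s)` is a NULL
direction of the Hessian of `Â` at `0` — it is a sum of three abelian directions, along each of which `Â` vanishes identically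
(✓`TwoScaleCalculus.hess_apply_eq_zero_of_line_const` + PSD Cauchy–Schwarz). [folklore] -/
theorem hess_hatA_dirOne_eq_zero (hx : w'.1.1.re ≠ 0) (hy' : w'.1.2.re ≠ 0) (hz : w'.2.re ≠ 0) (ha : a₀ ≠ 0) (hf : ∀ i, 0 < (y i).re)
    (s : ℝ) (w : RawSpace L) : hess (hatA L a₀ w' y) 0 (dirOne L s w') w = 0 := by
  have hbase := baseLead_ne_zero hx hy' hz ha
  have hsm := contDiff_hatA (L := L) (y := y) hx hy' hz ha fun i => (hf i).ne'
  have h0 : hatA L a₀ w' y 0 = 0 := by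
    have := hatA_abelDir_eq_zero (L := L) hf hbase (compI w') (e := qI) (Or.inl rfl) 0
    simpa using this
  have hmin : ∀ v, hatA L a₀ w' y 0 ≤ hatA L a₀ w' y v := fun v => by rw [h0]; exact hatA_nonneg _ _ _ _
  have hnull : ∀ (c : Fin 4 → ℝ) {e : ℍ}, (e = qI ∨ e = qJ ∨ e = qK) → ∀ w, hess (hatA L a₀ w' y) 0 (abelDir L c e) w = 0 := by
    intro c e he w
    refine hess_apply_eq_zero_of_line_const hsm hmin (fun t => ?_) w
    rw [zero_add, hatA_abelDir_eq_zero hf hbase c he t, h0]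
  unfold dirOne
  rw [map_add, map_add]
  simp only [FunLike.coe_add, Pi.add_apply]
  rw [hnull _ (Or.inl rfl), hnull _ (Or.inr (Or.inl rfl)), hnull _ (Or.inr (Or.inr rfl)), add_zero, add_zero]

/-- ★★ **THE HORIZONTAL SLICES OF `G` HAVE VANISHING JETS OF ORDER `< 4` AT `u = 0`** (✓`TwoScaleCalculus.iteratedDeriv_parabola_eq_zero`). [folklore] -/
theorem iteratedDeriv_twoScaleDeficit_eq_zero (hx : w'.1.1.re ≠ 0) (hy' : w'.1.2.re ≠ 0) (hz : w'.2.re ≠ 0) (ha : a₀ ≠ 0) (hf : ∀ i, 0 < (y i).re)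
    (s : ℝ) (k : ℕ) (hk : k < 4) : iteratedDeriv k (fun t : ℝ => twoScaleDeficit L t s a₀ w' y) 0 = 0 := by
  have hbase := baseLead_ne_zero hx hy' hz ha
  have hsm := contDiff_hatA (L := L) (y := y) hx hy' hz ha fun i => (hf i).ne'
  have h0 : hatA L a₀ w' y 0 = 0 := by
    have := hatA_abelDir_eq_zero (L := L) hf hbase (compI w') (e := qI) (Or.inl rfl) 0
    simpa using this
  have hmin : ∀ v, hatA L a₀ w' y 0 ≤ hatA L a₀ w' y v := fun v => by rw [h0]; exact hatA_nonneg _ _ _ _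
  have hpar := iteratedDeriv_parabola_eq_zero hsm hmin (hess_hatA_dirOne_eq_zero hx hy' hz ha hf s) (dirTwo L s y) k hk
  have hfun : (fun u : ℝ => -hatA L a₀ w' y 0 + hatA L a₀ w' y (0 + u • dirOne L s w' + u ^ 2 • dirTwo L s y)) =
      fun t : ℝ => twoScaleDeficit L t s a₀ w' y := by
    funext u
    rw [h0, neg_zero, zero_add, zero_add, twoScaleDeficit_eq_hatA]
  rwa [hfun] at hpar

/-- `G(u, 0; ξ) = 0`: at `s = 0` the family is an `i`-toron with trivial followers. [folklore] -/
theorem twoScaleDeficit_zero_right (hx : w'.1.1.re ≠ 0) (hy' : w'.1.2.re ≠ 0) (hz : w'.2.re ≠ 0) (ha : a₀ ≠ 0) (hf : ∀ i, 0 < (y i).re) (u : ℝ) :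
    twoScaleDeficit L u 0 a₀ w' y = 0 := by
  rw [twoScaleDeficit_eq_hatA, dirOne_zero, dirTwo_zero, smul_zero, add_zero]
  exact hatA_abelDir_eq_zero hf (baseLead_ne_zero hx hy' hz ha) _ (Or.inl rfl) u

/-- `G(0, s; ξ) = 0`: at `u = 0` every letter is real. [folklore] -/
theorem twoScaleDeficit_zero_left (hx : w'.1.1.re ≠ 0) (hy' : w'.1.2.re ≠ 0) (hz : w'.2.re ≠ 0) (ha : a₀ ≠ 0) (hf : ∀ i, 0 < (y i).re) (s : ℝ) :
    twoScaleDeficit L 0 s a₀ w' y = 0 := by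
  rw [twoScaleDeficit_eq_hatA, zero_smul, zero_pow two_ne_zero, zero_smul, add_zero]
  have := hatA_abelDir_eq_zero (L := L) hf (baseLead_ne_zero hx hy' hz ha) (compI w') (e := qI) (Or.inl rfl) 0
  simpa using this

/-- ★★★ **THE STRUCTURE THEOREM FOR THE PERIODIC TWO-SCALE DEFICIT**: at every non-degenerate blow-up point with positive follower real parts,
`G(u, s; ξ) = u⁴ · s² · Φ(u, s; ξ)` for ALL `(u, s)`, with `Φ = twoScaleRemainder` of the slice, continuous on the plane
(✓`TwoScaleCalculus.eq_pow_four_mul_sq_of_slices`; inputs: joint smoothness ✓PM-I½, toron flatness ✓§A, non-negativity). [cite: Luscher1983, §2] [cite: GonzalezarroyoAltes1988] -/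
theorem twoScaleDeficit_eq_pow_four_mul_sq (hx : w'.1.1.re ≠ 0) (hy' : w'.1.2.re ≠ 0) (hz : w'.2.re ≠ 0) (ha : a₀ ≠ 0) (hf : ∀ i, 0 < (y i).re) (u s : ℝ) :
    twoScaleDeficit L u s a₀ w' y = u ^ 4 * s ^ 2 * twoScaleRemainder (fun q : ℝ × ℝ => twoScaleDeficit L q.1 q.2 a₀ w' y) u s := by
  have hF : ContDiff ℝ ∞ (fun q : ℝ × ℝ => twoScaleDeficit L q.1 q.2 a₀ w' y) := contDiff_twoScaleDeficit_pair hx hy' hz ha fun i => (hf i).ne'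
  exact eq_pow_four_mul_sq_of_slices hF (fun q => twoScaleDeficit_nonneg _ _ _ _ _)
    (fun u => twoScaleDeficit_zero_right hx hy' hz ha hf u) (fun s => twoScaleDeficit_zero_left hx hy' hz ha hf s)
    (fun s => iteratedDeriv_twoScaleDeficit_eq_zero hx hy' hz ha hf s 2 (by norm_num))
    (fun s => iteratedDeriv_twoScaleDeficit_eq_zero hx hy' hz ha hf s 3 (by norm_num)) u s

/-- ★★ **THE JOINT TWO-SCALE LIMIT OF THE DEFICIT**: `G(u, s; ξ)/(u⁴s²) → Φ(0, 0; ξ)` as `(u, s) → (0, 0)` off the axes; the fibre condition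
`G ≤ (u²s)² = u⁴s²` becomes `Φ ≤ 1` in the limit. [folklore] -/
theorem tendsto_twoScaleDeficit_div (hx : w'.1.1.re ≠ 0) (hy' : w'.1.2.re ≠ 0) (hz : w'.2.re ≠ 0) (ha : a₀ ≠ 0) (hf : ∀ i, 0 < (y i).re) :
    Tendsto (fun q : ℝ × ℝ => twoScaleDeficit L q.1 q.2 a₀ w' y / (q.1 ^ 4 * q.2 ^ 2)) (𝓝[{q | q.1 ≠ 0 ∧ q.2 ≠ 0}] (0, 0))
      (𝓝 (twoScaleRemainder (fun q : ℝ × ℝ => twoScaleDeficit L q.1 q.2 a₀ w' y) 0 0)) := by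
  have hF : ContDiff ℝ ∞ (fun q : ℝ × ℝ => twoScaleDeficit L q.1 q.2 a₀ w' y) := contDiff_twoScaleDeficit_pair hx hy' hz ha fun i => (hf i).ne'
  have hc := (continuous_twoScaleRemainder hF).tendsto (0, 0)
  refine (hc.mono_left nhdsWithin_le_nhds).congr' ?_
  filter_upwards [self_mem_nhdsWithin] with q hq
  have hne : q.1 ^ 4 * q.2 ^ 2 ≠ 0 := mul_ne_zero (pow_ne_zero 4 hq.1) (pow_ne_zero 2 hq.2)
  rw [twoScaleDeficit_eq_pow_four_mul_sq hx hy' hz ha hf q.1 q.2]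
  exact (mul_div_cancel_left₀ _ hne).symm

/-- ★ On the two-scale fibre (`u ≠ 0`, `s ≠ 0`) the deficit condition `G ≤ (u²s)²` IS `Φ ≤ 1`. [folklore] -/
theorem twoScaleDeficit_le_iff (hx : w'.1.1.re ≠ 0) (hy' : w'.1.2.re ≠ 0) (hz : w'.2.re ≠ 0) (ha : a₀ ≠ 0) (hf : ∀ i, 0 < (y i).re)
    {u s : ℝ} (hu : u ≠ 0) (hs : s ≠ 0) :
    twoScaleDeficit L u s a₀ w' y ≤ (u ^ 2 * s) ^ 2 ↔ twoScaleRemainder (fun q : ℝ × ℝ => twoScaleDeficit L q.1 q.2 a₀ w' y) u s ≤ 1 := by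
  rw [twoScaleDeficit_eq_pow_four_mul_sq hx hy' hz ha hf u s]
  have hpos : 0 < u ^ 4 * s ^ 2 := by positivity
  rw [show (u ^ 2 * s) ^ 2 = u ^ 4 * s ^ 2 * 1 by ring]
  exact ⟨fun h => le_of_mul_le_mul_left h hpos, fun h => mul_le_mul_of_nonneg_left h hpos.le⟩

end Structure

end Summit.QuantumFields.YangMills.Theorems.SwapVirialDeficit.BlowUpRing

end
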